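import Mathlib
import HarnessLib
import Summits.Ventures.LatticeQCDFlow.Exactness.SUNJitteredHMCCertificates
import Summits.Ventures.LatticeQCDFlow.Exactness.SUNMetropolisORSweepFiguresOfMerit
import Summits.Ventures.LatticeQCDFlow.Exactness.CabibboMarinariORSweepFiguresOfMerit
import Summits.Ventures.LatticeQCDFlow.Exactness.SUNLeapfrogHMCORSweepFiguresOfMerit
import Summits.Ventures.LatticeQCDFlow.Scoring.DoeblinSkeleton
import Summits.Ventures.LatticeQCDFlow.Scoring.SplitChainFreshPairMoments

/-!
# `τ_int` of EVERY bounded observable — not only of events — is bounded by ONE constant per chain, for the engine's composites whose certificate is a minorisation by the Wilson measure itself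

HONEST FRAMING: exact (Metropolis-corrected) sampling algorithms for lattice gauge theory;
figures of merit are autocorrelation/cost numbers at stated couplings and volumes; no
continuum-physics claim.

Venture `LatticeQCDFlow` (cell pub-lqcd), topic `Exactness`, FANOUT row 9 (eng-latcore, GEN-23).  NEW WORK of the
cell over the tree, nothing cited as a fact, no number claimed: GEN-23's certificates BY THE TARGET
(`wilsonJitterHMC_exactStep_certificate`, `wilson_sunLeapfrogHMCN_exactStep_certificate`,
`wilson_sunMetropolis_orSweep_certificate`, `wilson_cmSweep_orSweep_certificate` — each `ε' • π ≤ K^m(U, ·)` with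
`π` the Wilson measure ITSELF), row 8's `Scoring/DoeblinSkeleton.tauInt_le_of_doeblin_nHit` (`τ_int(f) ≤ m/ε − 1/2`
for every bounded measurable `π`-centred `f` when the `m`-step kernel dominates `ε · π`).  The GEN-23 figures-of-merit
files bounded `τ_int` of EVENTS (`setACF`) and the asymptotic VARIANCE `σ²_f` of bounded observables; this file adds
the scorers' `τ_int` OF THE OBSERVABLE ITSELF (`Scoring.tauInt` of `t ↦ γ_f(t)/γ_f(0)`, `γ_f` the stationary
autocovariance of `f − π f`) — the quantity `τ̂_int = σ̂²_BM/(2 v̂)` estimates (GEN-23 `…_tauInt_tendstoInMeasure`) — for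
the plaquette, a Polyakov loop, a flowed charge, any bounded measurable `f`.  Printed counterparts NAMED ONLY:
Sokal 1997 §2; Madras–Sokal 1988.

## Content (torus `(ℤ/L)^d`, `G = SU(N)`; every bound has the shape `∃ m ε', 0 < m ∧ 0 < ε' ≤ 1 ∧ ∀ f measurable with
## |f| ≤ C: τ_int(ρ_f) ≤ m/ε' − 1/2` — the certificate's own constants, ONE bound for all bounded observables of the chain;
## the centring `f − π f` by row 8's `Scoring.centred_observable_bounds`)

* **`wilsonJitterHMC_exactStep_tauInt_autocov_le`** — the engine's jittered `SU(N)` HMC followed by ANY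
  Wilson-invariant step (one short atom; `τ₀` on `N, d, L, β`).
* **`wilson_sunLeapfrogHMCN_exactStep_tauInt_autocov_le`** — the DEFAULT fixed-step `'hmc'` (+ any exact step,
  `'+ n_or × or'`), `nstep·ε ≤ τ₀`.
* **`wilson_sunMetropolis_orSweep_tauInt_autocov_le`** — `'metro' + n_or × 'or'` (`L ≥ 2`).
* **`wilson_cmSweep_orSweep_tauInt_autocov_le`** — `'hb' (Cabibbo–Marinari) + n_or × 'or'` (`L ≥ 2`; one step:
  the bound is `1/ε' − 1/2`).

NOT CLAIMED: any value of `m`, `ε'`; chains whose certificate minorises by a reference law other than `π` (the jittered HMC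
alone, the `u1_2d` / `cpn_2d` HMC, the PTBC cycle — their EVENT `τ_int` and `σ²_f` bounds are in the GEN-23
figures-of-merit files; the observable `τ_int` would follow after comparing the reference law with `π`, not done);
unbounded observables; floating point.
-/

noncomputable section

namespace Summit.Ventures.LatticeQCDFlow.Exactness

open MeasureTheory ProbabilityTheory ProbabilityTheory.Kernel Set Function Filter Topology
open Literature.MathematicalPhysics.QuantumFieldTheory
open Literature.MathematicalPhysics.QuantumLattice (fundamentalRep continuous_fundamentalRep)
open scoped ENNReal Matrix Matrix.Norms.Operator NNReal

set_option backward.isDefEq.respectTransparency false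

/-! ## §1 The engine's composites -/

section Engine

variable (N : ℕ) [NeZero N] {d L : ℕ} [NeZero L] (β : ℝ)
variable {Lab : Type*} [Countable Lab] [MeasurableSpace Lab] [MeasurableSingletonClass Lab]

/-- **`τ_int` OF EVERY BOUNDED OBSERVABLE UNDER THE ENGINE'S JITTERED `SU(N)` HMC FOLLOWED BY ANY EXACT STEP — ONE
CONSTANT PER CHAIN** (`'hmc' (tau_jitter) + n_or × 'or'`, one short atom of the jitter law): there is `τ₀ > 0` (on
`N, d, L, β` only) such that for EVERY `nstep`, `τ`, `η`, atom `l₀` (`η{l₀} ≠ 0`, `nstep l₀ ≥ 1`, `0 < τ l₀ ≤ τ₀`) and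
EVERY Markov `P` leaving `π = wilsonMeasure (β/N)` invariant there is `T ≥ 0` with `τ_int(ρ_f) ≤ T` for EVERY bounded
measurable `f`. -/
theorem wilsonJitterHMC_exactStep_tauInt_autocov_le :
    ∃ τ₀ : ℝ, 0 < τ₀ ∧ ∀ (nstep : Lab → ℕ) (τ : Lab → ℝ) (η : Measure Lab) [IsProbabilityMeasure η] (l₀ : Lab),
      1 ≤ nstep l₀ → η {l₀} ≠ 0 → 0 < τ l₀ → τ l₀ ≤ τ₀ →
      ∀ (P : Kernel (GaugeConfig d L (Matrix.specialUnitaryGroup (Fin N) ℂ)) (GaugeConfig d L (Matrix.specialUnitaryGroup (Fin N) ℂ)))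
        [IsMarkovKernel P], Invariant P (wilsonMeasure (d := d) (L := L) (fundamentalRep (Fin N)) (β / N)) →
      ∃ m : ℕ, ∃ ε' : ℝ≥0∞, 0 < m ∧ 0 < ε' ∧ ε' ≤ 1 ∧ ∀ (f : GaugeConfig d L (Matrix.specialUnitaryGroup (Fin N) ℂ) → ℝ), Measurable f → ∀ C : ℝ, (∀ U, |f U| ≤ C) →
        Scoring.tauInt (fun t =>
            Scoring.autocov (P ∘ₖ wilsonJitterHMC N d L β nstep τ η) (wilsonMeasure (d := d) (L := L) (fundamentalRep (Fin N)) (β / N))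
                (fun y => f y - ∫ z, f z ∂(wilsonMeasure (d := d) (L := L) (fundamentalRep (Fin N)) (β / N))) t
              / Scoring.autocov (P ∘ₖ wilsonJitterHMC N d L β nstep τ η) (wilsonMeasure (d := d) (L := L) (fundamentalRep (Fin N)) (β / N))
                (fun y => f y - ∫ z, f z ∂(wilsonMeasure (d := d) (L := L) (fundamentalRep (Fin N)) (β / N))) 0) ≤ m / ε'.toReal - 1 / 2 := by
  obtain ⟨τ₀, hτ₀, h⟩ := wilsonJitterHMC_exactStep_certificate (N := N) (d := d) (L := L) (Lab := Lab) β
  refine ⟨τ₀, hτ₀, fun nstep τ η _ l₀ hn hl₀ hτl hτl₀ P _ hP => ?_⟩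
  obtain ⟨hinv, m, ε', hm, hε0, hε1, hmin⟩ := h nstep τ η l₀ hn hl₀ hτl hτl₀ P hP
  haveI := isMarkovKernel_wilsonJitterHMC (N := N) (d := d) (L := L) β nstep τ η
  refine ⟨m, ε', hm, hε0, hε1, fun f hf C hC => ?_⟩
  obtain ⟨hfm, hfb, hf0⟩ := Scoring.centred_observable_bounds (wilsonMeasure (d := d) (L := L) (fundamentalRep (Fin N)) (β / N)) hf hC
  exact Scoring.tauInt_le_of_doeblin_nHit hinv (GeneralNCMC.minorised_setwise hmin) hm hε0 hfm hfb hf0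

/-- **`τ_int` OF EVERY BOUNDED OBSERVABLE UNDER THE DEFAULT FIXED-STEP `'hmc'` FOLLOWED BY ANY EXACT STEP**
(`nstep·ε ≤ τ₀`; `'+ n_or × or'` in particular): ONE `T ≥ 0` per chain with `τ_int(ρ_f) ≤ T` for every bounded
measurable `f`. -/
theorem wilson_sunLeapfrogHMCN_exactStep_tauInt_autocov_le :
    ∃ τ₀ : ℝ, 0 < τ₀ ∧ ∀ (nstep : ℕ) (ε : ℝ), 1 ≤ nstep → 0 < ε → nstep * ε ≤ τ₀ →
      ∀ (P : Kernel (GaugeConfig d L (Matrix.specialUnitaryGroup (Fin N) ℂ)) (GaugeConfig d L (Matrix.specialUnitaryGroup (Fin N) ℂ)))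
        [IsMarkovKernel P], Invariant P (wilsonMeasure (d := d) (L := L) (fundamentalRep (Fin N)) (β / N)) →
      ∀ [IsMarkovKernel (sunLeapfrogHMCN (sunCoordι N) (sunCoordι_skew N) ε (Measure.addHaar : Measure (SUNCoords N))
            (sunKinetic N) (measurable_halfKick_sun N (measurable_sunWilsonForceLaw_coeConfig N (d := d) (L := L) β) ε)
            (fun U => β / N * wilsonAction (fundamentalRep (Fin N)) U) nstep)],
      ∃ m : ℕ, ∃ ε' : ℝ≥0∞, 0 < m ∧ 0 < ε' ∧ ε' ≤ 1 ∧ ∀ (f : GaugeConfig d L (Matrix.specialUnitaryGroup (Fin N) ℂ) → ℝ), Measurable f → ∀ C : ℝ, (∀ U, |f U| ≤ C) →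
        Scoring.tauInt (fun t =>
            Scoring.autocov (P ∘ₖ sunLeapfrogHMCN (sunCoordι N) (sunCoordι_skew N) ε (Measure.addHaar : Measure (SUNCoords N))
            (sunKinetic N) (measurable_halfKick_sun N (measurable_sunWilsonForceLaw_coeConfig N (d := d) (L := L) β) ε)
            (fun U => β / N * wilsonAction (fundamentalRep (Fin N)) U) nstep) (wilsonMeasure (d := d) (L := L) (fundamentalRep (Fin N)) (β / N))
                (fun y => f y - ∫ z, f z ∂(wilsonMeasure (d := d) (L := L) (fundamentalRep (Fin N)) (β / N))) t
              / Scoring.autocov (P ∘ₖ sunLeapfrogHMCN (sunCoordι N) (sunCoordι_skew N) ε (Measure.addHaar : Measure (SUNCoords N))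
            (sunKinetic N) (measurable_halfKick_sun N (measurable_sunWilsonForceLaw_coeConfig N (d := d) (L := L) β) ε)
            (fun U => β / N * wilsonAction (fundamentalRep (Fin N)) U) nstep) (wilsonMeasure (d := d) (L := L) (fundamentalRep (Fin N)) (β / N))
                (fun y => f y - ∫ z, f z ∂(wilsonMeasure (d := d) (L := L) (fundamentalRep (Fin N)) (β / N))) 0) ≤ m / ε'.toReal - 1 / 2 := by
  obtain ⟨τ₀, hτ₀, h⟩ := wilson_sunLeapfrogHMCN_exactStep_certificate N (d := d) (L := L) β
  refine ⟨τ₀, hτ₀, fun nstep ε hn hε hτ P _ hP _ => ?_⟩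
  obtain ⟨hinv, m, ε', hm, hε0, hε1, hmin⟩ := h nstep ε hn hε hτ P hP
  refine ⟨m, ε', hm, hε0, hε1, fun f hf C hC => ?_⟩
  obtain ⟨hfm, hfb, hf0⟩ := Scoring.centred_observable_bounds (wilsonMeasure (d := d) (L := L) (fundamentalRep (Fin N)) (β / N)) hf hC
  exact Scoring.tauInt_le_of_doeblin_nHit hinv (GeneralNCMC.minorised_setwise hmin) hm hε0 hfm hfb hf0

end Engine

section Sweeps

variable (N : ℕ) [NeZero N] (s : ℝ) [Fact (0 < s)] {d L : ℕ} {m : Type*} [Fintype m] [DecidableEq m]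

/-- **`τ_int` OF EVERY BOUNDED OBSERVABLE UNDER THE ENGINE'S `'metro' + n_or × 'or'` COMPOSITE** (`L ≥ 2`, any `β`,
kick size `s > 0`, `nhit ≥ 1`, scan through every link, ANY OR schedule): ONE `T ≥ 0` with `τ_int(ρ_f) ≤ T` for every
bounded measurable `f`, `π = wilsonMeasure (suRep N) β`. -/
theorem wilson_sunMetropolis_orSweep_tauInt_autocov_le [NeZero L] (hL : 2 ≤ L) (β : ℝ) {nhit : ℕ} (hn : 1 ≤ nhit)
    {Ls : List (Edge d L)} (hLs : ∀ e, e ∈ Ls) (sched : List (Edge d L × (Fin N ≃ Fin 2 ⊕ m)))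
    [IsMarkovKernel (metropolisSweep (sunMetropolisKick N s)
      (fun U : GaugeConfig d L (Matrix.specialUnitaryGroup (Fin N) ℂ) => Real.exp (-β * wilsonAction (suRep N) U)) nhit Ls)] :
    ∃ mm : ℕ, ∃ ε' : ℝ≥0∞, 0 < mm ∧ 0 < ε' ∧ ε' ≤ 1 ∧ ∀ (f : GaugeConfig d L (Matrix.specialUnitaryGroup (Fin N) ℂ) → ℝ), Measurable f → ∀ C : ℝ, (∀ U, |f U| ≤ C) →
      Scoring.tauInt (fun t =>
            Scoring.autocov (cmORSweep sched ∘ₖ metropolisSweep (sunMetropolisKick N s)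
            (fun U : GaugeConfig d L (Matrix.specialUnitaryGroup (Fin N) ℂ) => Real.exp (-β * wilsonAction (suRep N) U)) nhit Ls) (wilsonMeasure (d := d) (L := L) (suRep N) β)
                (fun y => f y - ∫ z, f z ∂(wilsonMeasure (d := d) (L := L) (suRep N) β)) t
              / Scoring.autocov (cmORSweep sched ∘ₖ metropolisSweep (sunMetropolisKick N s)
            (fun U : GaugeConfig d L (Matrix.specialUnitaryGroup (Fin N) ℂ) => Real.exp (-β * wilsonAction (suRep N) U)) nhit Ls) (wilsonMeasure (d := d) (L := L) (suRep N) β)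
                (fun y => f y - ∫ z, f z ∂(wilsonMeasure (d := d) (L := L) (suRep N) β)) 0) ≤ mm / ε'.toReal - 1 / 2 := by
  haveI := isProbabilityMeasure_wilsonMeasure_suRep N (d := d) (L := L) β
  obtain ⟨hinv, mm, ε', hmm, hε0, hε1, hmin⟩ :=
    wilson_sunMetropolis_orSweep_certificate N s (d := d) hL β hn hLs sched
  refine ⟨mm, ε', hmm, hε0, hε1, fun f hf C hC => ?_⟩
  obtain ⟨hfm, hfb, hf0⟩ := Scoring.centred_observable_bounds
    (wilsonMeasure (d := d) (L := L) (suRep N) β) hf hC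
  exact Scoring.tauInt_le_of_doeblin_nHit hinv (GeneralNCMC.minorised_setwise hmin) hmm hε0 hfm hfb hf0

omit [Fact (0 < s)] in
/-- **`τ_int` OF EVERY BOUNDED OBSERVABLE UNDER THE ENGINE'S `'hb' (Cabibbo–Marinari) + n_or × 'or'` COMPOSITE**
(`L ≥ 2`, any `β`, frames through all coordinate pairs, every link, ANY OR schedule): ONE `T ≥ 0` — here
`T = 1/ε' − 1/2`, ONE cycle — with `τ_int(ρ_f) ≤ T` for every bounded measurable `f`. -/
theorem wilson_cmSweep_orSweep_tauInt_autocov_le [NeZero L] (hL : 2 ≤ L) (β : ℝ) (frames : List (Fin N ≃ Fin 2 ⊕ m))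
    (hlex : frames.map pairOf = lexPairs (Finset.univ.sort (· ≤ ·) : List (Fin N)) ∨
      frames.map pairOf = (lexPairs (Finset.univ.sort (· ≤ ·) : List (Fin N))).reverse)
    {links : List (Edge d L)} (hl : ∀ e, e ∈ links) (sched : List (Edge d L × (Fin N ≃ Fin 2 ⊕ m)))
    [IsMarkovKernel (latSweep (gibbsDensity fun U : GaugeConfig d L (Matrix.specialUnitaryGroup (Fin N) ℂ) => β * wilsonAction (suRep N) U) frames links)] :
    ∃ ε' : ℝ≥0∞, 0 < ε' ∧ ε' ≤ 1 ∧ ∀ (f : GaugeConfig d L (Matrix.specialUnitaryGroup (Fin N) ℂ) → ℝ), Measurable f → ∀ C : ℝ, (∀ U, |f U| ≤ C) →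
      Scoring.tauInt (fun t =>
            Scoring.autocov (cmORSweep sched ∘ₖ latSweep (gibbsDensity fun U : GaugeConfig d L (Matrix.specialUnitaryGroup (Fin N) ℂ) => β * wilsonAction (suRep N) U) frames links) (wilsonMeasure (d := d) (L := L) (suRep N) β)
                (fun y => f y - ∫ z, f z ∂(wilsonMeasure (d := d) (L := L) (suRep N) β)) t
              / Scoring.autocov (cmORSweep sched ∘ₖ latSweep (gibbsDensity fun U : GaugeConfig d L (Matrix.specialUnitaryGroup (Fin N) ℂ) => β * wilsonAction (suRep N) U) frames links) (wilsonMeasure (d := d) (L := L) (suRep N) β)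
                (fun y => f y - ∫ z, f z ∂(wilsonMeasure (d := d) (L := L) (suRep N) β)) 0) ≤ 1 / ε'.toReal - 1 / 2 := by
  haveI := isProbabilityMeasure_wilsonMeasure_suRep N (d := d) (L := L) β
  obtain ⟨hinv, ε', hε0, hε1, hmin⟩ := wilson_cmSweep_orSweep_certificate N (d := d) hL β frames hlex hl sched
  refine ⟨ε', hε0, hε1, fun f hf C hC => ?_⟩
  obtain ⟨hfm, hfb, hf0⟩ := Scoring.centred_observable_bounds
    (wilsonMeasure (d := d) (L := L) (suRep N) β) hf hC
  simpa only [Nat.cast_one] using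
    Scoring.tauInt_le_of_doeblin_nHit hinv (GeneralNCMC.minorised_setwise hmin) Nat.one_pos hε0 hfm hfb hf0

end Sweeps

end Summit.Ventures.LatticeQCDFlow.Exactness

end
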